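import Literature.Analysis.FluidPDE.CompressibleEulerImplosionOriginSeriesGrowth
import Literature.Analysis.FluidPDE.CompressibleEulerImplosionOriginSeriesBall
import HarnessLib

/-!
# Buckmaster–Cao-Labora–Gómez-Serrano at `γ = 5/3`: the certified centre expansion of the pinned profile on `x ≤ −1/3`

Companion of `…OriginSeriesGrowth` (the coefficient bounds `|wⱼ(r)| ≤ B_j` of the centre series on the
shooting window `r ∈ [13890041/12500000, 697/625]`) and `…OriginSeriesBall` (the exponential substitution
`ζ = c eˣ`). The profile functions of the crux `DenseExcursion` (line `sonic-cavity-renewal`, clause (d) of the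
cavity tube) are, on the core, the even/odd parts of the centre series read in `ζ = c eˣ` (`c = e^{T₀}`, the
sonic time of the `P₀` orbit):

  `W(x) = −Σ_{k odd} w_k ζ^{k−1} = Wser r c x`,   `eˣ S(x) = Σ_{k even} w_k ζᵏ/(3c) = eˣ · Sser r c x`.

Main result `centre_expansion_window2`: for every `r` in the window, every `c ∈ [1/3, 10/21]` and every
`x ≤ −1/3`, the six inequalities of CavityTube (d) hold for `(Wser r c, Sser r c)` with
`W₂ = −w₃c²`, `s₀ = 1/(3c)`, `s₂ = w₂c/3` and remainder `2e^{4x}`, together with `|W₂| ≤ 1/10`,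
`7/10 ≤ s₀ ≤ 1`, `|s₂| ≤ 1/10`. Proof: termwise `x`-differentiation (`…OriginSeriesBall`), the remainders are
the series from order `ζ⁴` on, bounded termwise by the certified majorant `B` at `ζ̄ = 3414/10000 ≥ (10/21)e^{−1/3}`:
heads (orders `≤ 60`) summed exactly in `ℚ` by the kernel, tails by the growth lemma (`λζ̄ < 1`, `λ = 73/25`);
the two resulting constants are `≤ 30 ≤ min(2/c⁴, 6/c³)/…`. No facts, no axioms.

[cite: BuckmasterCaolaboraGomezserrano2025, Prop. 2.5, eq. (2.12), App. B]
-/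

noncomputable section

open Filter Topology

namespace Literature.Analysis.FluidPDE

namespace BuckmasterCaolaboraGomezserrano2025

namespace OriginSeries

namespace CentreW2

set_option linter.style.longLine false
set_option linter.style.setOption false
set_option maxRecDepth 100000
set_option maxHeartbeats 4000000

/-! ### The series profile functions -/

/-- Coefficients of `W` in `ζ = c eˣ`: `a_j = −w_{j+1}` for even `j`, `0` for odd `j`.
[cite: BuckmasterCaolaboraGomezserrano2025, Prop. 2.5] -/
def aW (r : ℝ) (j : ℕ) : ℝ := if j % 2 = 0 then -w r 1 (j + 1) else 0

/-- Coefficients of `eˣ S` in `ζ = c eˣ`: `b_j = w_j/(3c)` for even `j`, `0` for odd `j`.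
[cite: BuckmasterCaolaboraGomezserrano2025, Prop. 2.5] -/
def aS (r c : ℝ) (j : ℕ) : ℝ := if j % 2 = 0 then w r 1 j / (3 * c) else 0

/-- The series velocity profile `W(x) = Σ a_j (c eˣ)ʲ = −Σ_{k odd} w_k (c eˣ)^{k−1}`.
[cite: BuckmasterCaolaboraGomezserrano2025, Prop. 2.5] -/
def Wser (r c : ℝ) : ℝ → ℝ := xSeries (aW r) c

/-- The series sound-speed profile `S(x) = e^{−x} Σ b_j (c eˣ)ʲ` (so that `eˣ S(x) = Σ_{k even} w_k (c eˣ)ᵏ/(3c)`).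
[cite: BuckmasterCaolaboraGomezserrano2025, Prop. 2.5] -/
def Sser (r c : ℝ) : ℝ → ℝ := fun x => Real.exp (-x) * xSeries (aS r c) c x

variable {r c : ℝ}

/-! ### Coefficient bounds on the window -/

/-- `|w_j| ≤ λ^j` on the window. [cite: BuckmasterCaolaboraGomezserrano2025, App. B] -/
theorem abs_w_le_pow (hr : r ∈ Set.Icc ((13890041/12500000 : ℚ) : ℝ) ((697/625 : ℚ) : ℝ)) (j : ℕ) :
    |w r 1 j| ≤ (73 / 25 : ℝ) ^ j := by
  have h := abs_w_weight_le hr j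
  have h1 : (1 : ℝ) ≤ ((j : ℝ) + 1) ^ 2 := one_le_pow₀ (by linarith [(Nat.cast_nonneg j : (0 : ℝ) ≤ j)])
  calc |w r 1 j| = |w r 1 j| * 1 := (mul_one _).symm
    _ ≤ |w r 1 j| * ((j : ℝ) + 1) ^ 2 := mul_le_mul_of_nonneg_left h1 (abs_nonneg _)
    _ ≤ _ := h

/-- [folklore] -/
theorem aW_bound (hr : r ∈ Set.Icc ((13890041/12500000 : ℚ) : ℝ) ((697/625 : ℚ) : ℝ)) :
    ∀ k : ℕ, |aW r k| ≤ (73 / 25 : ℝ) * ((k : ℝ) + 1) ^ (0 : ℕ) * (73 / 25 : ℝ) ^ k := by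
  intro k
  rw [pow_zero, mul_one]
  unfold aW
  split_ifs
  · rw [abs_neg, ← pow_succ']
    exact abs_w_le_pow hr (k + 1)
  · rw [abs_zero]; positivity

/-- [folklore] -/
theorem aS_bound (hr : r ∈ Set.Icc ((13890041/12500000 : ℚ) : ℝ) ((697/625 : ℚ) : ℝ)) (hc : 0 < c) :
    ∀ k : ℕ, |aS r c k| ≤ 1 / (3 * c) * ((k : ℝ) + 1) ^ (0 : ℕ) * (73 / 25 : ℝ) ^ k := by
  intro k
  rw [pow_zero, mul_one]
  unfold aS
  split_ifs
  · rw [abs_div, abs_of_pos (by positivity : (0 : ℝ) < 3 * c), div_eq_mul_one_div, mul_comm]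
    exact mul_le_mul_of_nonneg_left (abs_w_le_pow hr k) (by positivity)
  · rw [abs_zero]; positivity

/-- `0 ≤ B_i` (on the window). [folklore] -/
theorem Bb_nonneg (hr : r ∈ Set.Icc ((13890041/12500000 : ℚ) : ℝ) ((697/625 : ℚ) : ℝ)) (i : ℕ) : 0 ≤ Bb i :=
  (abs_nonneg _).trans (abs_w_le_Bb hr i)

/-- `B_i ≤ λ^i`. [folklore] -/
theorem Bb_le_pow (i : ℕ) : Bb i ≤ (73 / 25 : ℝ) ^ i := by
  rcases le_or_gt i 60 with hi | hi
  · rw [Bb_of_le hi]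
    have h2 := of_headChk 61 headChk_ok i (by omega)
    have h2' : (((hQ i * (((i : ℚ) + 1) ^ 2) : ℚ)) : ℝ) ≤ (((lamQ ^ i : ℚ)) : ℝ) := by exact_mod_cast h2
    push_cast at h2'
    rw [lamQ_cast] at h2'
    have h1 : (1 : ℝ) ≤ ((i : ℝ) + 1) ^ 2 := one_le_pow₀ (by linarith [(Nat.cast_nonneg i : (0 : ℝ) ≤ i)])
    have h0 : 0 ≤ ((hQ i : ℚ) : ℝ) := by
      have : 0 ≤ (((hQ i * (((i : ℚ) + 1) ^ 2) : ℚ)) : ℝ) := by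
        have hq : (0 : ℚ) ≤ hQ i * (((i : ℚ) + 1) ^ 2) := by
          unfold hQ getZ
          have : (0 : ℚ) ≤ (MAJW2.getD i 0 : ℚ) := by
            have hall : ∀ z ∈ MAJW2, (0 : ℤ) ≤ z := by decide
            rcases lt_or_ge i MAJW2.length with hl | hl
            · have := hall _ (List.getElem_mem hl)
              rw [List.getD_eq_getElem _ _ hl]; exact_mod_cast this
            · rw [List.getD_eq_default _ _ hl]; simp
          positivity
        exact_mod_cast hq
      push_cast at this
      nlinarith [this, h1]
    calc ((hQ i : ℚ) : ℝ) = ((hQ i : ℚ) : ℝ) * 1 := (mul_one _).symm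
      _ ≤ ((hQ i : ℚ) : ℝ) * ((i : ℝ) + 1) ^ 2 := mul_le_mul_of_nonneg_left h1 h0
      _ ≤ _ := h2'
  · rw [Bb_of_lt hi]
    have hi' : (60 : ℝ) < i := by exact_mod_cast hi
    have hi3 : (1 : ℝ) ≤ (i : ℝ) ^ 3 := one_le_pow₀ (by linarith)
    have hpow : (0 : ℝ) ≤ (73 / 25 : ℝ) ^ i := by positivity
    calc (1 / 400000 : ℝ) * (73 / 25 : ℝ) ^ i / (i : ℝ) ^ 3 ≤ (1 / 400000 : ℝ) * (73 / 25 : ℝ) ^ i / 1 := by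
          gcongr
      _ ≤ _ := by rw [div_one]; nlinarith

/-! ### The two certified majorants of the remainders -/

/-- Majorant of the `W`-family remainders: `γ_W(j) = j²·B_{j+1}` for even `j`. [folklore] -/
def gW (j : ℕ) : ℝ := if j % 2 = 0 then (j : ℝ) ^ 2 * Bb (j + 1) else 0

/-- Majorant of the `S`-family remainders: `γ_S(j) = j²·B_j` for even `j`. [folklore] -/
def gS (j : ℕ) : ℝ := if j % 2 = 0 then (j : ℝ) ^ 2 * Bb j else 0

/-- [folklore] -/
theorem gW_nonneg (hr : r ∈ Set.Icc ((13890041/12500000 : ℚ) : ℝ) ((697/625 : ℚ) : ℝ)) (j : ℕ) : 0 ≤ gW j := by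
  unfold gW; split_ifs
  · exact mul_nonneg (by positivity) (Bb_nonneg hr _)
  · exact le_rfl

/-- [folklore] -/
theorem gS_nonneg (hr : r ∈ Set.Icc ((13890041/12500000 : ℚ) : ℝ) ((697/625 : ℚ) : ℝ)) (j : ℕ) : 0 ≤ gS j := by
  unfold gS; split_ifs
  · exact mul_nonneg (by positivity) (Bb_nonneg hr _)
  · exact le_rfl

/-- Termwise domination, `W`-family: `(n+4)^m |a_{n+4}| t^{n+4} ≤ γ_W(n+4) t^{n+4}` for `m ≤ 2`. [folklore] -/
theorem key_W (hr : r ∈ Set.Icc ((13890041/12500000 : ℚ) : ℝ) ((697/625 : ℚ) : ℝ)) {t : ℝ} (ht : 0 ≤ t)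
    {m : ℕ} (hm : m ≤ 2) (n : ℕ) :
    (((n + 4 : ℕ) : ℝ)) ^ m * |aW r (n + 4)| * t ^ (n + 4) ≤ gW (n + 4) * t ^ (n + 4) := by
  refine mul_le_mul_of_nonneg_right ?_ (by positivity)
  unfold aW gW
  by_cases h : (n + 4) % 2 = 0
  · rw [if_pos h, if_pos h, abs_neg]
    have h1 : (((n + 4 : ℕ) : ℝ)) ^ m ≤ (((n + 4 : ℕ) : ℝ)) ^ 2 :=
      pow_le_pow_right₀ (by push_cast; linarith [(Nat.cast_nonneg n : (0 : ℝ) ≤ n)]) hm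
    exact mul_le_mul h1 (abs_w_le_Bb hr _) (abs_nonneg _) (by positivity)
  · rw [if_neg h, if_neg h, abs_zero, mul_zero]

/-- Termwise domination, `S`-family: `(n+4)^m |b_{n+4}| t^{n+4} ≤ γ_S(n+4)/(3c) · t^{n+4}` for `m ≤ 2`. [folklore] -/
theorem key_S (hr : r ∈ Set.Icc ((13890041/12500000 : ℚ) : ℝ) ((697/625 : ℚ) : ℝ)) (hc : 0 < c) {t : ℝ} (ht : 0 ≤ t)
    {m : ℕ} (hm : m ≤ 2) (n : ℕ) :
    (((n + 4 : ℕ) : ℝ)) ^ m * |aS r c (n + 4)| * t ^ (n + 4) ≤ gS (n + 4) / (3 * c) * t ^ (n + 4) := by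
  refine mul_le_mul_of_nonneg_right ?_ (by positivity)
  unfold aS gS
  by_cases h : (n + 4) % 2 = 0
  · rw [if_pos h, if_pos h, abs_div, abs_of_pos (by positivity : (0 : ℝ) < 3 * c), mul_div_assoc]
    have h1 : (((n + 4 : ℕ) : ℝ)) ^ m ≤ (((n + 4 : ℕ) : ℝ)) ^ 2 :=
      pow_le_pow_right₀ (by push_cast; linarith [(Nat.cast_nonneg n : (0 : ℝ) ≤ n)]) hm
    refine mul_le_mul h1 ?_ (by positivity) (by positivity)
    exact div_le_div_of_nonneg_right (abs_w_le_Bb hr _) (by positivity)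
  · rw [if_neg h, if_neg h, abs_zero, mul_zero, zero_div]

/-! ### The generic fourth-order remainder estimate -/

/-- **Remainder after four terms.** If `|f_{n+4}| ≤ γ_{n+4} t^{n+4}`, `0 ≤ t ≤ ζ̄` and `Σ γ_{n+4} ζ̄ⁿ = M`, then
`|Σ f − (f₀ + f₁ + f₂ + f₃)| ≤ t⁴ M`. [folklore] -/
theorem abs_sub_head4_le {f γ : ℕ → ℝ} {s t zb M : ℝ} (hf : HasSum f s) (ht0 : 0 ≤ t) (htz : t ≤ zb)
    (hγ : ∀ n, |f (n + 4)| ≤ γ (n + 4) * t ^ (n + 4)) (hγ0 : ∀ n, 0 ≤ γ n)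
    (hM : HasSum (fun n => γ (n + 4) * zb ^ n) M) :
    |s - (f 0 + f 1 + f 2 + f 3)| ≤ t ^ 4 * M := by
  have h4 : HasSum (fun n => f (n + 4)) (s - ∑ i ∈ Finset.range 4, f i) := (hasSum_nat_add_iff' 4).mpr hf
  have hsum4 : ∑ i ∈ Finset.range 4, f i = f 0 + f 1 + f 2 + f 3 := by
    simp [Finset.sum_range_succ]
  rw [hsum4] at h4
  refine abs_le_of_hasSum_le h4 (hM.mul_left (t ^ 4)) fun n => ?_
  calc |f (n + 4)| ≤ γ (n + 4) * t ^ (n + 4) := hγ n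
    _ = t ^ 4 * (γ (n + 4) * t ^ n) := by ring
    _ ≤ t ^ 4 * (γ (n + 4) * zb ^ n) := by
        have := hγ0 (n + 4)
        gcongr

/-! ### Kernel side: the two head sums and the tail constant -/

/-- `ζ̄ = 3414/10000 ≥ (10/21)·e^{−1/3}`. [folklore] -/
def zbQ : ℚ := 3414 / 10000

/-- `γ_W(n+4)` over `ℚ` for `n + 5 ≤ 60`. [folklore] -/
def gWQ (n : ℕ) : ℚ := if (n + 4) % 2 = 0 then (((n + 4 : ℕ) : ℚ)) ^ 2 * hQ (n + 5) else 0

/-- `γ_S(n+4)` over `ℚ` for `n + 4 ≤ 60`. [folklore] -/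
def gSQ (n : ℕ) : ℚ := if (n + 4) % 2 = 0 then (((n + 4 : ℕ) : ℚ)) ^ 2 * hQ (n + 4) else 0

/-- Head of `M_W`: `Σ_{n<56} γ_W(n+4) ζ̄ⁿ`. [folklore] -/
def headWQ : ℚ := sumQ (fun n => gWQ n * zbQ ^ n) 56

/-- Head of `M_S`: `Σ_{n<57} γ_S(n+4) ζ̄ⁿ`. [folklore] -/
def headSQ : ℚ := sumQ (fun n => gSQ n * zbQ ^ n) 57

/-- Tail constant `Θλ⁵/(61(1 − λζ̄))`. [folklore] -/
def tailQ : ℚ := thetaQ * lamQ ^ 5 / 61 / (1 - lamQ * zbQ)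

/-- The two certified constants (`22.9…` and `15.2…`) are `≤ 30`. [folklore] -/
theorem heads_ok : headWQ + tailQ ≤ 30 ∧ headSQ + tailQ ≤ 30 := by
  constructor <;> decide +kernel

/-- `λζ̄ < 1`. [folklore] -/
theorem lam_zb_lt_one : (73 / 25 : ℝ) * (3414 / 10000) < 1 := by norm_num

/-- [folklore] -/
theorem zbQ_cast : ((zbQ : ℚ) : ℝ) = 3414 / 10000 := by unfold zbQ; push_cast; ring

/-- [folklore] -/
theorem tailQ_cast : ((tailQ : ℚ) : ℝ) = (1 / 400000 : ℝ) * (73 / 25 : ℝ) ^ 5 / 61 / (1 - (73 / 25 : ℝ) * (3414 / 10000)) := by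
  unfold tailQ; push_cast; rw [thetaQ_cast, lamQ_cast, zbQ_cast]

/-! ### Real side: the two majorant sums are `≤ 30` -/

/-- Summability of `γ_W(n+4) ζ̄ⁿ`. [folklore] -/
theorem summable_gW (hr : r ∈ Set.Icc ((13890041/12500000 : ℚ) : ℝ) ((697/625 : ℚ) : ℝ)) :
    Summable (fun n : ℕ => gW (n + 4) * (3414 / 10000 : ℝ) ^ n) := by
  have hgeo := summable_succ_pow_mul_geometric 2 (by norm_num : (0 : ℝ) < 73 / 25 * (3414 / 10000)) lam_zb_lt_one
  refine Summable.of_nonneg_of_le (fun n => mul_nonneg (gW_nonneg hr _) (by positivity)) (fun n => ?_)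
    (hgeo.mul_left (16 * (73 / 25 : ℝ) ^ 5))
  unfold gW
  split_ifs
  · have hB := Bb_le_pow (n + 4 + 1)
    have hB0 := Bb_nonneg hr (n + 4 + 1)
    have hn : (((n + 4 : ℕ) : ℝ)) ^ 2 ≤ 16 * ((n : ℝ) + 1) ^ 2 := by push_cast; nlinarith [(Nat.cast_nonneg n : (0 : ℝ) ≤ n)]
    calc (((n + 4 : ℕ) : ℝ)) ^ 2 * Bb (n + 4 + 1) * (3414 / 10000 : ℝ) ^ n
        ≤ (16 * ((n : ℝ) + 1) ^ 2) * (73 / 25 : ℝ) ^ (n + 4 + 1) * (3414 / 10000 : ℝ) ^ n := by gcongr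
      _ = 16 * (73 / 25 : ℝ) ^ 5 * (((n : ℝ) + 1) ^ 2 * (73 / 25 * (3414 / 10000)) ^ n) := by
          rw [mul_pow, show n + 4 + 1 = n + 5 from rfl, pow_add]; ring
  · rw [zero_mul]; positivity

/-- Summability of `γ_S(n+4) ζ̄ⁿ`. [folklore] -/
theorem summable_gS (hr : r ∈ Set.Icc ((13890041/12500000 : ℚ) : ℝ) ((697/625 : ℚ) : ℝ)) :
    Summable (fun n : ℕ => gS (n + 4) * (3414 / 10000 : ℝ) ^ n) := by
  have hgeo := summable_succ_pow_mul_geometric 2 (by norm_num : (0 : ℝ) < 73 / 25 * (3414 / 10000)) lam_zb_lt_one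
  refine Summable.of_nonneg_of_le (fun n => mul_nonneg (gS_nonneg hr _) (by positivity)) (fun n => ?_)
    (hgeo.mul_left (16 * (73 / 25 : ℝ) ^ 4))
  unfold gS
  split_ifs
  · have hB := Bb_le_pow (n + 4)
    have hB0 := Bb_nonneg hr (n + 4)
    have hn : (((n + 4 : ℕ) : ℝ)) ^ 2 ≤ 16 * ((n : ℝ) + 1) ^ 2 := by push_cast; nlinarith [(Nat.cast_nonneg n : (0 : ℝ) ≤ n)]
    calc (((n + 4 : ℕ) : ℝ)) ^ 2 * Bb (n + 4) * (3414 / 10000 : ℝ) ^ n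
        ≤ (16 * ((n : ℝ) + 1) ^ 2) * (73 / 25 : ℝ) ^ (n + 4) * (3414 / 10000 : ℝ) ^ n := by gcongr
      _ = 16 * (73 / 25 : ℝ) ^ 4 * (((n : ℝ) + 1) ^ 2 * (73 / 25 * (3414 / 10000)) ^ n) := by
          rw [mul_pow, pow_add]; ring
  · rw [zero_mul]; positivity

/-- The geometric tail series. [folklore] -/
theorem hasSum_tail : HasSum (fun n : ℕ => (1 / 400000 : ℝ) * (73 / 25 : ℝ) ^ 5 / 61 * (73 / 25 * (3414 / 10000 : ℝ)) ^ n)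
    ((tailQ : ℚ) : ℝ) := by
  rw [tailQ_cast, div_eq_mul_inv _ (1 - (73 / 25 : ℝ) * (3414 / 10000))]
  exact (hasSum_geometric_of_lt_one (by norm_num : (0 : ℝ) ≤ 73 / 25 * (3414 / 10000)) lam_zb_lt_one).mul_left
    ((1 / 400000 : ℝ) * (73 / 25 : ℝ) ^ 5 / 61)

/-- A tail term of `M_W`: `γ_W(n+60) ζ̄^{n+56} ≤ (Θλ⁵/61)(λζ̄)ⁿ`. [folklore] -/
theorem gW_tail_le (n : ℕ) :
    gW (n + 56 + 4) * (3414 / 10000 : ℝ) ^ (n + 56) ≤ (1 / 400000 : ℝ) * (73 / 25 : ℝ) ^ 5 / 61 * (73 / 25 * (3414 / 10000 : ℝ)) ^ n := by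
  unfold gW
  split_ifs
  · rw [Bb_of_lt (by omega)]
    have e1 : n + 56 + 4 + 1 = n + 61 := by omega
    rw [e1]
    have hn0 : (0 : ℝ) ≤ n := Nat.cast_nonneg n
    have h61 : (61 : ℝ) ≤ ((n + 61 : ℕ) : ℝ) := by push_cast; linarith
    have hpos : (0 : ℝ) < ((n + 61 : ℕ) : ℝ) := by linarith
    -- (n+60)²/(n+61)³ ≤ 1/61
    have hrat : (((n + 56 + 4 : ℕ) : ℝ)) ^ 2 / (((n + 61 : ℕ) : ℝ)) ^ 3 ≤ 1 / 61 := by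
      rw [div_le_div_iff₀ (by positivity) (by norm_num)]
      push_cast
      nlinarith [sq_nonneg ((n : ℝ) + 61)]
    -- (λζ̄)^(n+56) ≤ (λζ̄)^n
    have hgeo : (73 / 25 * (3414 / 10000 : ℝ)) ^ (n + 56) ≤ (73 / 25 * (3414 / 10000 : ℝ)) ^ n :=
      pow_le_pow_of_le_one (by norm_num) lam_zb_lt_one.le (by omega)
    calc (((n + 56 + 4 : ℕ) : ℝ)) ^ 2 * (1 / 400000 * (73 / 25 : ℝ) ^ (n + 61) / (((n + 61 : ℕ) : ℝ)) ^ 3) * (3414 / 10000 : ℝ) ^ (n + 56)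
        = (1 / 400000 * (73 / 25 : ℝ) ^ 5) * ((((n + 56 + 4 : ℕ) : ℝ)) ^ 2 / (((n + 61 : ℕ) : ℝ)) ^ 3)
            * (73 / 25 * (3414 / 10000 : ℝ)) ^ (n + 56) := by
          rw [mul_pow, show n + 61 = 5 + (n + 56) by omega, pow_add]
          field_simp
      _ ≤ (1 / 400000 * (73 / 25 : ℝ) ^ 5) * (1 / 61) * (73 / 25 * (3414 / 10000 : ℝ)) ^ n := by
          gcongr
      _ = _ := by ring
  · rw [zero_mul]; positivity

/-- A tail term of `M_S`: `γ_S(n+61) ζ̄^{n+57} ≤ (Θλ⁵/61)(λζ̄)ⁿ`. [folklore] -/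
theorem gS_tail_le (n : ℕ) :
    gS (n + 57 + 4) * (3414 / 10000 : ℝ) ^ (n + 57) ≤ (1 / 400000 : ℝ) * (73 / 25 : ℝ) ^ 5 / 61 * (73 / 25 * (3414 / 10000 : ℝ)) ^ n := by
  unfold gS
  split_ifs
  · rw [Bb_of_lt (by omega)]
    have e1 : n + 57 + 4 = n + 61 := by omega
    rw [e1]
    have hn0 : (0 : ℝ) ≤ n := Nat.cast_nonneg n
    have hpos : (0 : ℝ) < ((n + 61 : ℕ) : ℝ) := by push_cast; linarith
    have hrat : (((n + 61 : ℕ) : ℝ)) ^ 2 / (((n + 61 : ℕ) : ℝ)) ^ 3 ≤ 1 / 61 := by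
      rw [div_le_div_iff₀ (by positivity) (by norm_num)]
      push_cast
      nlinarith [sq_nonneg ((n : ℝ) + 61)]
    have hgeo : (73 / 25 * (3414 / 10000 : ℝ)) ^ (n + 57) ≤ (73 / 25 * (3414 / 10000 : ℝ)) ^ n :=
      pow_le_pow_of_le_one (by norm_num) lam_zb_lt_one.le (by omega)
    have hlam : (73 / 25 : ℝ) ^ 4 ≤ (73 / 25 : ℝ) ^ 5 := pow_le_pow_right₀ (by norm_num) (by norm_num)
    calc (((n + 61 : ℕ) : ℝ)) ^ 2 * (1 / 400000 * (73 / 25 : ℝ) ^ (n + 61) / (((n + 61 : ℕ) : ℝ)) ^ 3) * (3414 / 10000 : ℝ) ^ (n + 57)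
        = (1 / 400000 * (73 / 25 : ℝ) ^ 4) * ((((n + 61 : ℕ) : ℝ)) ^ 2 / (((n + 61 : ℕ) : ℝ)) ^ 3)
            * (73 / 25 * (3414 / 10000 : ℝ)) ^ (n + 57) := by
          rw [mul_pow, show n + 61 = 4 + (n + 57) by omega, pow_add]
          field_simp
      _ ≤ (1 / 400000 * (73 / 25 : ℝ) ^ 5) * (1 / 61) * (73 / 25 * (3414 / 10000 : ℝ)) ^ n := by
          gcongr
      _ = _ := by ring
  · rw [zero_mul]; positivity

/-- The head of `M_W` is the kernel-computed rational. [folklore] -/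
theorem headW_eq : ∑ n ∈ Finset.range 56, gW (n + 4) * (3414 / 10000 : ℝ) ^ n = ((headWQ : ℚ) : ℝ) := by
  unfold headWQ
  rw [sumQ_cast]
  refine Finset.sum_congr rfl fun n hn => ?_
  rw [Finset.mem_range] at hn
  unfold gW gWQ
  by_cases h : (n + 4) % 2 = 0
  · rw [if_pos h, if_pos h, Bb_of_le (by omega), show n + 4 + 1 = n + 5 from rfl]
    push_cast [zbQ_cast]
    ring
  · rw [if_neg h, if_neg h]
    simp

/-- The head of `M_S` is the kernel-computed rational. [folklore] -/
theorem headS_eq : ∑ n ∈ Finset.range 57, gS (n + 4) * (3414 / 10000 : ℝ) ^ n = ((headSQ : ℚ) : ℝ) := by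
  unfold headSQ
  rw [sumQ_cast]
  refine Finset.sum_congr rfl fun n hn => ?_
  rw [Finset.mem_range] at hn
  unfold gS gSQ
  by_cases h : (n + 4) % 2 = 0
  · rw [if_pos h, if_pos h, Bb_of_le (by omega)]
    push_cast [zbQ_cast]
    ring
  · rw [if_neg h, if_neg h]
    simp

/-- **`M_W ≤ 30`.** [cite: BuckmasterCaolaboraGomezserrano2025, App. B] -/
theorem MW_le (hr : r ∈ Set.Icc ((13890041/12500000 : ℚ) : ℝ) ((697/625 : ℚ) : ℝ)) :
    ∑' n : ℕ, gW (n + 4) * (3414 / 10000 : ℝ) ^ n ≤ 30 := by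
  have hs := summable_gW hr
  rw [← hs.sum_add_tsum_nat_add 56, headW_eq]
  have htail : ∑' n : ℕ, gW (n + 56 + 4) * (3414 / 10000 : ℝ) ^ (n + 56) ≤ ((tailQ : ℚ) : ℝ) :=
    hasSum_le gW_tail_le ((summable_nat_add_iff 56).mpr hs).hasSum hasSum_tail
  have hh : (((headWQ + tailQ : ℚ)) : ℝ) ≤ 30 := by exact_mod_cast heads_ok.1
  push_cast at hh
  linarith

/-- **`M_S ≤ 30`.** [cite: BuckmasterCaolaboraGomezserrano2025, App. B] -/
theorem MS_le (hr : r ∈ Set.Icc ((13890041/12500000 : ℚ) : ℝ) ((697/625 : ℚ) : ℝ)) :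
    ∑' n : ℕ, gS (n + 4) * (3414 / 10000 : ℝ) ^ n ≤ 30 := by
  have hs := summable_gS hr
  rw [← hs.sum_add_tsum_nat_add 57, headS_eq]
  have htail : ∑' n : ℕ, gS (n + 57 + 4) * (3414 / 10000 : ℝ) ^ (n + 57) ≤ ((tailQ : ℚ) : ℝ) :=
    hasSum_le gS_tail_le ((summable_nat_add_iff 57).mpr hs).hasSum hasSum_tail
  have hh : (((headSQ + tailQ : ℚ)) : ℝ) ≤ 30 := by exact_mod_cast heads_ok.2
  push_cast at hh
  linarith

/-! ### The range of `ζ = c eˣ` -/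

/-- `e^{−1/3} ≤ 7169/10000`. [folklore] -/
theorem exp_neg_third_le : Real.exp (-(1 / 3 : ℝ)) ≤ 7169 / 10000 := by
  have h := Real.sum_le_exp_of_nonneg (show (0 : ℝ) ≤ 1 / 3 by norm_num) 5
  have hs : ∑ i ∈ Finset.range 5, (1 / 3 : ℝ) ^ i / (Nat.factorial i) = 2713 / 1944 := by
    simp [Finset.sum_range_succ, Nat.factorial]
    norm_num
  rw [hs] at h
  rw [Real.exp_neg]
  apply inv_le_of_inv_le₀ (by norm_num)
  linarith

/-- For `c ≤ 10/21` and `x ≤ −1/3`: `0 < c eˣ ≤ ζ̄` and `λ·c eˣ < 1`. [folklore] -/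
theorem zeta_range {x : ℝ} (hc0 : 0 < c) (hc : c ≤ 10 / 21) (hx : x ≤ -(1 / 3 : ℝ)) :
    0 < c * Real.exp x ∧ c * Real.exp x ≤ 3414 / 10000 ∧ (73 / 25 : ℝ) * (c * Real.exp x) < 1 := by
  have h1 : Real.exp x ≤ 7169 / 10000 := (Real.exp_le_exp.mpr hx).trans exp_neg_third_le
  have h0 : 0 < Real.exp x := Real.exp_pos x
  have h2 : c * Real.exp x ≤ 10 / 21 * (7169 / 10000) := mul_le_mul hc h1 h0.le (by norm_num)
  refine ⟨by positivity, by linarith, by nlinarith⟩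

/-! ### The main theorem -/

/-- `eˣ · Sser = xSeries b` as functions. [folklore] -/
theorem exp_mul_Sser (r c : ℝ) : (fun y => Real.exp y * Sser r c y) = xSeries (aS r c) c := by
  funext y
  unfold Sser
  rw [← mul_assoc, ← Real.exp_add, add_neg_cancel, Real.exp_zero, one_mul]

/-- **The certified centre expansion on `x ≤ −1/3`** (clause (d) of the cavity tube for the series profile,
uniformly in the speed `r ∈ [13890041/12500000, 697/625]` and the sonic scale `c ∈ [1/3, 10/21]`): with
`W₂ = −w₃c²`, `s₀ = 1/(3c)`, `s₂ = w₂c/3` one has `|W₂| ≤ 1/10`, `7/10 ≤ s₀ ≤ 1`, `|s₂| ≤ 1/10` and, for every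
`x ≤ −1/3`, the six second-order expansions of `W`, `W′`, `W″`, `eˣS`, `(eˣS)′`, `(eˣS)″` in `e^{2x}` with
remainder `2e^{4x}`. [cite: BuckmasterCaolaboraGomezserrano2025, Prop. 2.5, App. B] -/
theorem centre_expansion_window2 (hr : r ∈ Set.Icc ((13890041/12500000 : ℚ) : ℝ) ((697/625 : ℚ) : ℝ))
    (hc : c ∈ Set.Icc (1 / 3 : ℝ) (10 / 21)) :
    |(-(w r 1 3) * c ^ 2)| ≤ 1 / 10 ∧ 7 / 10 ≤ 1 / (3 * c) ∧ 1 / (3 * c) ≤ 1 ∧ |w r 1 2 * c / 3| ≤ 1 / 10 ∧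
    ∀ x : ℝ, x ≤ -(1 / 3 : ℝ) →
      |Wser r c x - (r - 1) - (-(w r 1 3) * c ^ 2) * Real.exp (2 * x)| ≤ 2 * Real.exp (4 * x) ∧
      |deriv (Wser r c) x - 2 * (-(w r 1 3) * c ^ 2) * Real.exp (2 * x)| ≤ 2 * Real.exp (4 * x) ∧
      |deriv (deriv (Wser r c)) x - 4 * (-(w r 1 3) * c ^ 2) * Real.exp (2 * x)| ≤ 2 * Real.exp (4 * x) ∧
      |Real.exp x * Sser r c x - 1 / (3 * c) - (w r 1 2 * c / 3) * Real.exp (2 * x)| ≤ 2 * Real.exp (4 * x) ∧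
      |deriv (fun y => Real.exp y * Sser r c y) x - 2 * (w r 1 2 * c / 3) * Real.exp (2 * x)| ≤ 2 * Real.exp (4 * x) ∧
      |deriv (deriv (fun y => Real.exp y * Sser r c y)) x - 4 * (w r 1 2 * c / 3) * Real.exp (2 * x)|
        ≤ 2 * Real.exp (4 * x) := by
  obtain ⟨hc1, hc2⟩ := hc
  have hc0 : 0 < c := by linarith
  -- the enclosed constants
  obtain ⟨h2lo, h2hi⟩ := centre_coeff_boundsW2 hr (i := 2) (by norm_num)
  obtain ⟨h3lo, h3hi⟩ := centre_coeff_boundsW2 hr (i := 3) (by norm_num)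
  have hw2 : |w r 1 2| ≤ 1728000000001 / 10000000000000 := by
    have e1 : (((bndsW2.getD 2 (0, 0)).1 : ℚ) : ℝ) = 1668049199999 / 10000000000000 := by
      rw [show bndsW2.getD 2 (0, 0) = (1668049199999/10000000000000, 1728000000001/10000000000000) by rfl]; push_cast; ring
    have e2 : (((bndsW2.getD 2 (0, 0)).2 : ℚ) : ℝ) = 1728000000001 / 10000000000000 := by
      rw [show bndsW2.getD 2 (0, 0) = (1668049199999/10000000000000, 1728000000001/10000000000000) by rfl]; push_cast; ring
    rw [e1] at h2lo; rw [e2] at h2hi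
    rw [abs_le]; constructor <;> linarith
  have hw3 : |w r 1 3| ≤ 1834865043937 / 10000000000000 := by
    have e1 : (((bndsW2.getD 3 (0, 0)).1 : ℚ) : ℝ) = -1834865043937 / 10000000000000 := by
      rw [show bndsW2.getD 3 (0, 0) = (-1834865043937/10000000000000, -177906798931/1000000000000) by rfl]; push_cast; ring
    have e2 : (((bndsW2.getD 3 (0, 0)).2 : ℚ) : ℝ) = -177906798931 / 1000000000000 := by
      rw [show bndsW2.getD 3 (0, 0) = (-1834865043937/10000000000000, -177906798931/1000000000000) by rfl]; push_cast; ring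
    rw [e1] at h3lo; rw [e2] at h3hi
    rw [abs_le]; constructor <;> linarith
  refine ⟨?_, ?_, ?_, ?_, fun x hx => ?_⟩
  · rw [abs_mul, abs_neg, abs_of_nonneg (by positivity : (0 : ℝ) ≤ c ^ 2)]
    have hc4 : c ^ 2 ≤ (10 / 21 : ℝ) ^ 2 := pow_le_pow_left₀ hc0.le hc2 2
    nlinarith [abs_nonneg (w r 1 3)]
  · rw [le_div_iff₀ (by positivity)]; linarith
  · rw [div_le_iff₀ (by positivity)]; linarith
  · rw [abs_div, abs_mul, abs_of_pos hc0, abs_of_pos (by norm_num : (0 : ℝ) < 3)]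
    rw [div_le_iff₀ (by norm_num)]
    nlinarith [abs_nonneg (w r 1 2)]
  -- a point `x ≤ -1/3`
  obtain ⟨ht0, htz, hμ⟩ := zeta_range hc0 hc2 hx
  have he2 : Real.exp (2 * x) = Real.exp x ^ 2 := by rw [← Real.exp_nat_mul]; norm_num
  have he4 : Real.exp (4 * x) = Real.exp x ^ 4 := by rw [← Real.exp_nat_mul]; norm_num
  have ht2 : c ^ 2 * Real.exp (2 * x) = (c * Real.exp x) ^ 2 := by rw [he2]; ring
  have ht4 : (c * Real.exp x) ^ 4 = c ^ 4 * Real.exp (4 * x) := by rw [he4]; ring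
  -- final numeric comparisons: `t⁴·30 ≤ 2e^{4x}` and `t⁴·30/(3c) ≤ 2e^{4x}`
  have hc4 : c ^ 4 ≤ (10 / 21 : ℝ) ^ 4 := pow_le_pow_left₀ hc0.le hc2 4
  have hc3 : c ^ 3 ≤ (10 / 21 : ℝ) ^ 3 := pow_le_pow_left₀ hc0.le hc2 3
  have hE : 0 < Real.exp (4 * x) := Real.exp_pos _
  have hfinW : (c * Real.exp x) ^ 4 * 30 ≤ 2 * Real.exp (4 * x) := by
    rw [ht4]; nlinarith
  have hfinS : (c * Real.exp x) ^ 4 * (30 / (3 * c)) ≤ 2 * Real.exp (4 * x) := by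
    rw [ht4, show c ^ 4 * Real.exp (4 * x) * (30 / (3 * c)) = c ^ 3 * Real.exp (4 * x) * 10 by field_simp; ring]
    nlinarith
  -- the majorant sums
  have hMW : HasSum (fun n => gW (n + 4) * (3414 / 10000 : ℝ) ^ n) (∑' n : ℕ, gW (n + 4) * (3414 / 10000 : ℝ) ^ n) :=
    (summable_gW hr).hasSum
  have hMS : HasSum (fun n => gS (n + 4) / (3 * c) * (3414 / 10000 : ℝ) ^ n)
      ((∑' n : ℕ, gS (n + 4) * (3414 / 10000 : ℝ) ^ n) / (3 * c)) := by
    have := (summable_gS hr).hasSum.div_const (3 * c)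
    refine this.congr_fun fun n => ?_
    ring
  have hMWle := MW_le hr
  have hMSle := MS_le hr
  have hMW0 : 0 ≤ ∑' n : ℕ, gW (n + 4) * (3414 / 10000 : ℝ) ^ n :=
    tsum_nonneg fun n => mul_nonneg (gW_nonneg hr _) (by positivity)
  have hMS0 : 0 ≤ ∑' n : ℕ, gS (n + 4) * (3414 / 10000 : ℝ) ^ n :=
    tsum_nonneg fun n => mul_nonneg (gS_nonneg hr _) (by positivity)
  have hgS0 : ∀ n, 0 ≤ gS n / (3 * c) := fun n => div_nonneg (gS_nonneg hr n) (by positivity)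
  -- the six power series and their head terms
  have hW0 := hasSum_xSeries (aW_bound hr) (by norm_num) hc0 hμ
  have hW1 := hasSum_deriv_xSeries (aW_bound hr) (by norm_num) hc0 hμ
  have hW2 := hasSum_deriv2_xSeries (aW_bound hr) (by norm_num) hc0 hμ
  have hS0 := hasSum_xSeries (aS_bound hr hc0) (by norm_num) hc0 hμ
  have hS1 := hasSum_deriv_xSeries (aS_bound hr hc0) (by norm_num) hc0 hμ
  have hS2 := hasSum_deriv2_xSeries (aS_bound hr hc0) (by norm_num) hc0 hμ
  have hw1 : w r 1 1 = 1 - r := w_one one_ne_zero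
  have a0 : aW r 0 = r - 1 := by unfold aW; simp [hw1]
  have a1 : aW r 1 = 0 := by unfold aW; simp
  have a2 : aW r 2 = -(w r 1 3) := by unfold aW; simp
  have a3 : aW r 3 = 0 := by unfold aW; simp
  have b0 : aS r c 0 = 1 / (3 * c) := by unfold aS; simp
  have b1 : aS r c 1 = 0 := by unfold aS; simp
  have b2 : aS r c 2 = w r 1 2 / (3 * c) := by unfold aS; simp
  have b3 : aS r c 3 = 0 := by unfold aS; simp
  refine ⟨?_, ?_, ?_, ?_, ?_, ?_⟩
  · -- W
    have hR := abs_sub_head4_le hW0 ht0.le htz (fun n => by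
        have := key_W hr ht0.le (m := 0) (by norm_num) n
        rw [pow_zero, one_mul] at this
        rwa [abs_mul, abs_pow, abs_of_nonneg ht0.le])
      (gW_nonneg hr) hMW
    have e : Wser r c x - (r - 1) - (-(w r 1 3) * c ^ 2) * Real.exp (2 * x)
        = xSeries (aW r) c x - (aW r 0 * (c * Real.exp x) ^ 0 + aW r 1 * (c * Real.exp x) ^ 1 + aW r 2 * (c * Real.exp x) ^ 2 + aW r 3 * (c * Real.exp x) ^ 3) := by
      rw [a0, a1, a2, a3, ← ht2]; unfold Wser; ring
    rw [e]
    exact hR.trans ((mul_le_mul_of_nonneg_left hMWle (by positivity)).trans hfinW)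
  · -- W'
    have hR := abs_sub_head4_le hW1 ht0.le htz (fun n => by
        have := key_W hr ht0.le (m := 1) (by norm_num) n
        rw [pow_one] at this
        rwa [abs_mul, abs_mul, abs_of_nonneg (by positivity : (0 : ℝ) ≤ ((n + 4 : ℕ) : ℝ)), abs_pow, abs_of_nonneg ht0.le])
      (gW_nonneg hr) hMW
    have e : deriv (Wser r c) x - 2 * (-(w r 1 3) * c ^ 2) * Real.exp (2 * x)
        = deriv (xSeries (aW r) c) x - (((0 : ℕ) : ℝ) * aW r 0 * (c * Real.exp x) ^ 0 + ((1 : ℕ) : ℝ) * aW r 1 * (c * Real.exp x) ^ 1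
            + ((2 : ℕ) : ℝ) * aW r 2 * (c * Real.exp x) ^ 2 + ((3 : ℕ) : ℝ) * aW r 3 * (c * Real.exp x) ^ 3) := by
      rw [a1, a2, a3]; unfold Wser; push_cast; rw [← ht2]; ring
    rw [e]
    exact hR.trans ((mul_le_mul_of_nonneg_left hMWle (by positivity)).trans hfinW)
  · -- W''
    have hR := abs_sub_head4_le hW2 ht0.le htz (fun n => by
        have := key_W hr ht0.le (m := 2) le_rfl n
        rwa [abs_mul, abs_mul, abs_of_nonneg (by positivity : (0 : ℝ) ≤ (((n + 4 : ℕ) : ℝ)) ^ 2), abs_pow, abs_of_nonneg ht0.le])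
      (gW_nonneg hr) hMW
    have e : deriv (deriv (Wser r c)) x - 4 * (-(w r 1 3) * c ^ 2) * Real.exp (2 * x)
        = deriv (deriv (xSeries (aW r) c)) x - (((0 : ℕ) : ℝ) ^ 2 * aW r 0 * (c * Real.exp x) ^ 0 + ((1 : ℕ) : ℝ) ^ 2 * aW r 1 * (c * Real.exp x) ^ 1
            + ((2 : ℕ) : ℝ) ^ 2 * aW r 2 * (c * Real.exp x) ^ 2 + ((3 : ℕ) : ℝ) ^ 2 * aW r 3 * (c * Real.exp x) ^ 3) := by
      rw [a1, a2, a3]; unfold Wser; push_cast; rw [← ht2]; ring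
    rw [e]
    exact hR.trans ((mul_le_mul_of_nonneg_left hMWle (by positivity)).trans hfinW)
  · -- e^x S
    have hR := abs_sub_head4_le hS0 ht0.le htz (fun n => by
        have := key_S hr hc0 ht0.le (m := 0) (by norm_num) n
        rw [pow_zero, one_mul] at this
        rwa [abs_mul, abs_pow, abs_of_nonneg ht0.le])
      hgS0 hMS
    have e : Real.exp x * Sser r c x - 1 / (3 * c) - (w r 1 2 * c / 3) * Real.exp (2 * x)
        = xSeries (aS r c) c x - (aS r c 0 * (c * Real.exp x) ^ 0 + aS r c 1 * (c * Real.exp x) ^ 1 + aS r c 2 * (c * Real.exp x) ^ 2 + aS r c 3 * (c * Real.exp x) ^ 3) := by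
      rw [b0, b1, b2, b3, show Real.exp x * Sser r c x = (fun y => Real.exp y * Sser r c y) x from rfl, exp_mul_Sser]
      rw [show w r 1 2 * c / 3 * Real.exp (2 * x) = w r 1 2 / (3 * c) * (c ^ 2 * Real.exp (2 * x)) by field_simp, ht2]
      ring
    rw [e]
    refine hR.trans ?_
    calc (c * Real.exp x) ^ 4 * ((∑' n : ℕ, gS (n + 4) * (3414 / 10000 : ℝ) ^ n) / (3 * c)) ≤ (c * Real.exp x) ^ 4 * (30 / (3 * c)) := by
          gcongr
      _ ≤ _ := hfinS
  · -- (e^x S)'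
    have hR := abs_sub_head4_le hS1 ht0.le htz (fun n => by
        have := key_S hr hc0 ht0.le (m := 1) (by norm_num) n
        rw [pow_one] at this
        rwa [abs_mul, abs_mul, abs_of_nonneg (by positivity : (0 : ℝ) ≤ ((n + 4 : ℕ) : ℝ)), abs_pow, abs_of_nonneg ht0.le])
      hgS0 hMS
    have e : deriv (fun y => Real.exp y * Sser r c y) x - 2 * (w r 1 2 * c / 3) * Real.exp (2 * x)
        = deriv (xSeries (aS r c) c) x - (((0 : ℕ) : ℝ) * aS r c 0 * (c * Real.exp x) ^ 0 + ((1 : ℕ) : ℝ) * aS r c 1 * (c * Real.exp x) ^ 1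
            + ((2 : ℕ) : ℝ) * aS r c 2 * (c * Real.exp x) ^ 2 + ((3 : ℕ) : ℝ) * aS r c 3 * (c * Real.exp x) ^ 3) := by
      rw [b1, b2, b3, exp_mul_Sser]
      push_cast
      rw [show 2 * (w r 1 2 * c / 3) * Real.exp (2 * x) = 2 * (w r 1 2 / (3 * c)) * (c ^ 2 * Real.exp (2 * x)) by field_simp, ht2]
      ring
    rw [e]
    refine hR.trans ?_
    calc (c * Real.exp x) ^ 4 * ((∑' n : ℕ, gS (n + 4) * (3414 / 10000 : ℝ) ^ n) / (3 * c)) ≤ (c * Real.exp x) ^ 4 * (30 / (3 * c)) := by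
          gcongr
      _ ≤ _ := hfinS
  · -- (e^x S)''
    have hR := abs_sub_head4_le hS2 ht0.le htz (fun n => by
        have := key_S hr hc0 ht0.le (m := 2) le_rfl n
        rwa [abs_mul, abs_mul, abs_of_nonneg (by positivity : (0 : ℝ) ≤ (((n + 4 : ℕ) : ℝ)) ^ 2), abs_pow, abs_of_nonneg ht0.le])
      hgS0 hMS
    have e : deriv (deriv (fun y => Real.exp y * Sser r c y)) x - 4 * (w r 1 2 * c / 3) * Real.exp (2 * x)
        = deriv (deriv (xSeries (aS r c) c)) x - (((0 : ℕ) : ℝ) ^ 2 * aS r c 0 * (c * Real.exp x) ^ 0 + ((1 : ℕ) : ℝ) ^ 2 * aS r c 1 * (c * Real.exp x) ^ 1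
            + ((2 : ℕ) : ℝ) ^ 2 * aS r c 2 * (c * Real.exp x) ^ 2 + ((3 : ℕ) : ℝ) ^ 2 * aS r c 3 * (c * Real.exp x) ^ 3) := by
      rw [b1, b2, b3, exp_mul_Sser]
      push_cast
      rw [show 4 * (w r 1 2 * c / 3) * Real.exp (2 * x) = 4 * (w r 1 2 / (3 * c)) * (c ^ 2 * Real.exp (2 * x)) by field_simp, ht2]
      ring
    rw [e]
    refine hR.trans ?_
    calc (c * Real.exp x) ^ 4 * ((∑' n : ℕ, gS (n + 4) * (3414 / 10000 : ℝ) ^ n) / (3 * c)) ≤ (c * Real.exp x) ^ 4 * (30 / (3 * c)) := by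
          gcongr
      _ ≤ _ := hfinS

end CentreW2

end OriginSeries

end BuckmasterCaolaboraGomezserrano2025

end Literature.Analysis.FluidPDE
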